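import Literature.MathematicalPhysics.QuantumFieldTheory.ConformalBootstrap3D.DualFunctional
import Literature.MathematicalPhysics.QuantumFieldTheory.ONOPEAngleScan
import HarnessLib

/-!
# The OPE-angle scan and the OPE-norm bound for the `σ–ε` system (Kos–Poland–Simmons-Duffin–Vichi 2016, §2.1)

Source. F. Kos, D. Poland, D. Simmons-Duffin, A. Vichi, *Precision islands in the Ising and `O(N)`
models*, JHEP 08 (2016) 036, arXiv:1603.04436, §2.1 "Ising Model"
[KosPolandSimmonsDuffinVichi2016JHEP]. The system of five sum rules is that of
Kos–Poland–Simmons-Duffin 2014 [KosPolandSimmonsduffin2014, §3.2–3.3, eqs. (3.12)–(3.16)], typed in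
`SigmaEpsilonSystem.lean` (the data `SigmaEpsilonData`, axioms A1–A5, `BoxExcluded`,
`IsingEnclosure`) and `DualFunctional.lean` (`CrossingFunctional`, `identityTerm`, `evenForm`,
`oddForm`, `IsPositiveAt` = eq. (3.16), `AppliesTermwise`, `not_isPositiveAt_of_appliesTermwise`,
`boxExcluded_of_functional`). This file adds the two refinements of §2.1 of the 2016 paper that the
tree did not have: the OPE-ANGLE condition with its `θ`-scan, and the OPE-NORM bound.

What the source says (§2.1; quoted from the arXiv text, our glosses in brackets). After recalling
the conditions [(3.16) of 2014] — "`(1 1) α⃗·V⃗_{+,0,0} (1;1) > 0`, for the identity operator,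
`α⃗·V⃗_{+,Δ,ℓ} ⪰ 0`, for `ℤ₂`-even operators with even spin, `α⃗·V⃗_{-,Δ,ℓ} ≥ 0`, for `ℤ₂`-odd
operators in the spectrum. If such a functional can be found, then the assumed values of
`(Δ_σ, Δ_ε)` are incompatible with unitarity or reflection positivity" — the source continues:
"One can additionally incorporate the constraint `λ_σσε = λ_σεσ` by only requiring positivity for
the combination `α⃗·(V⃗_{+,Δ_ε,0} + V⃗_{-,Δ_σ,0} ⊗ (1 0; 0 0)) ⪰ 0`, reducing the size of the island
somewhat further. However, as noted in [KPSD 2014], [this] condition is still stronger than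
necessary. In particular it allows for solutions of crossing containing terms of the form
`Σ_i (λ_σσi λ_εεi)(V⃗_{+,Δ_ε,0} + V⃗_{-,Δ_σ,0} ⊗ (1 0; 0 0))(λ_σσi; λ_εεi)`, where `(λ_σσi λ_εεi)`
represent an arbitrary number of (not necessarily aligned) two-component vectors. If instead we
assume that `σ` and `ε` are isolated and that there are no other contributions at their scaling
dimensions, then we can replace [it] with the weaker condition
`(cos θ sin θ) α⃗·(V⃗_{+,Δ_ε,0} + V⃗_{-,Δ_σ,0} ⊗ (1 0; 0 0)) (cos θ; sin θ) ≥ 0`, for some unknown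
angle `θ ≡ tan⁻¹(λ_εεε/λ_σσε)`. By scanning over the possible values of `θ` and taking the union of
the resulting allowed regions […], we can effectively allow our functional to depend on this
unknown ratio and arrive at a smaller allowed region". And: "for any given allowed point in the
`(Δ_σ, Δ_ε, θ)` space, we can compute a lower and upper bound on the norm
`λ_ε ≡ √(λ_σσε² + λ_εεε²)` of the OPE coefficient vector. This is obtained by substituting the
conditions [(3.16)] with the optimization problem: Maximize `(1 1) α⃗·V⃗_{+,0,0} (1;1)` subject to
`𝒩 = (cos θ sin θ) α⃗·(V⃗_{+,Δ_ε,0} + V⃗_{-,Δ_σ,0} ⊗ (1 0; 0 0))(cos θ; sin θ)`,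
`α⃗·V⃗_{+,Δ,ℓ} ⪰ 0` for `ℤ₂`-even operators with even spin, `α⃗·V⃗_{-,Δ,ℓ} ≥ 0` for `ℤ₂`-odd
operators in the spectrum. By choosing `𝒩 = ±1` we can obtain the sought upper and lower bounds:
`𝒩 λ_ε² ≤ -(1 1) α⃗·V⃗_{+,0,0} (1;1)`."

What this file PROVES (the source states conditions; the implications are elementary real
analysis on top of `AppliesTermwise` and are proved here, exactly as `DualFunctional.lean` proves
the implication for eq. (3.16)):
* data side — `SigmaEpsilonData.HasIsolatedExternals D e s`, the extra spectral assumption of §2.1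
  on top of A1–A5: the index `e` of the even sum carries `ε` itself (`Δ = Δ_ε`, `ℓ = 0`) and is the
  ONLY even-sector scalar below `3`; the index `s` of the odd sum carries `σ` itself (`Δ = Δ_σ`,
  `ℓ = 0`) and is the only odd-sector scalar below `3`; and the OPE-coefficient symmetry
  `λ_σεσ = λ_σσε` (`D.lamσε s = D.lamσσ e`);
* functional side — `externalForm` (the quadratic form of
  `α⃗·(V⃗_{+,Δ_ε,0}[g_ε] + V⃗_{-,Δ_σ,0}[g_σ] ⊗ (1 0; 0 0))`), `IsBulkPositive` (second and third
  lines with the scalar gap `Δ ≥ 3`), `IsExtNonnegAt α Δσ Δε a b` (the external condition in the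
  direction `(a, b)`), `IsPositiveAtSym` (the "`⪰ 0`" version) and `IsPositiveAtAngle α Δσ Δε θ`
  (the weaker condition at angle `θ`); the comparisons `IsPositiveAt.isPositiveAtSym` and
  `IsPositiveAtSym.isPositiveAtAngle` ("still stronger than necessary"), and `π`-periodicity
  `isPositiveAtAngle_add_pi_iff` (only the line through `(cos θ, sin θ)` matters);
* the mechanism — `externalForm_add_identityTerm_nonpos`: for a datum with isolated externals on
  which `α⃗` acts termwise and is bulk-positive,
  `(λ_σσε λ_εεε)·ext·(λ_σσε; λ_εεε) + (1 1) α⃗·V⃗_{+,0,0} (1;1) ≤ 0`; hence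
  `not_isPositiveAtAngle_of_appliesTermwise` (a functional positive at THE angle of the datum
  excludes it), `false_of_forall_angle` (the `θ`-scan over the half-turn `[0, π)` excludes the
  point: the condition is quadratic, so `θ` and `θ + π` are the same check), and the OPE-norm bound
  `opeNormSq_bound`: `𝒩 · (λ_σσε² + λ_εεε²) ≤ -(1 1) α⃗·V⃗_{+,0,0} (1;1)` whenever the external
  form takes the value `𝒩` at the angle (any real `𝒩`; `𝒩 = ±1` are the source's two bounds);
* enclosure level — `IsoExcluded Q` (no datum satisfying A1–A5 with isolated externals has
  `(Δ_σ, Δ_ε) ∈ Q`), `TripleExcluded T` (none has `(Δ_σ, Δ_ε, θ) ∈ T` for an OPE angle `θ` of the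
  datum), `BoxExcluded.isoExcluded`, `tripleExcluded_of_functional`,
  `isoExcluded_of_tripleExcluded` (scanning `θ ∈ [0, π)` suffices), `isoExcluded_of_functionals`;
* certificate side (how finitely many checks cover all angles; elementary real algebra of ours,
  tagged with the source locus it serves) — homogeneity `externalForm_smul`, `isExtNonnegAt_smul_iff`; the CONE RULE
  `externalForm_nonneg_of_cone`: non-negativity at two directions `d₁, d₂` together with the
  polarisation condition "`B ≥ 0` or `B² ≤ 4 q(d₁) q(d₂)`" (`B = q(d₁+d₂) - q(d₁) - q(d₂)`) gives
  non-negativity on the closed cone spanned by `d₁, d₂` (via `quadForm_nonneg_of_det`);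
  `IsPositiveOnCone` and `IsPositiveOnCone.isPositiveAtAngle`; `exists_cone_of_angle`: every
  direction `(cos θ, sin θ)`, `θ ∈ [0, π)`, lies in the cone of two consecutive slope directions
  `(x_k, 1), (x_{k+1}, 1)` of a finite list `x_0, …, x_N`, or in one of the two end cones spanned
  by `(x_N, 1), (1, 0)` and by `(x_0, 1), (-1, 0)`; and the assembly
  `isoExcluded_of_slopeCells`: one evaluation-continuous functional per slope cell, positive on
  that cell's cone at every point of `Q`, excludes `Q` for data with isolated externals.

What this file does NOT contain: any concrete functional or certificate; any value of
`(Δ_σ, Δ_ε, θ)`; the `O(N)` version of §2.2 (the algebra of its angle condition is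
`ONOPEAngleScan.lean`); the optimisation problem itself (only its consequence, the bound, for a
GIVEN feasible `α⃗`); the claim that the physical Ising data has isolated externals (an assumption
of the source, here the hypothesis `HasIsolatedExternals`); termwise action for derivative
functionals (as in `DualFunctional.lean`, a hypothesis `AppliesTermwise`, discharged for
evaluation-continuous functionals by `appliesTermwise_of_isEvaluationContinuous`).

Design notes. (1) `θ` is not defined as `arctan(λ_εεε/λ_σσε)` (meaningless at `λ_σσε = 0`): the
theorems quantify over pairs `(θ, r)` with `λ_σσε = r cos θ`, `λ_εεε = r sin θ` (`r = ±λ_ε`), which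
is what the source's `tan⁻¹` denotes and covers `λ_σσε = 0`; `ONOPEAngleScan.exists_norm_angle_Ico`
supplies such a pair with `θ ∈ [0, π)` for every real vector. (2) "no other contributions at their
scaling dimensions" is typed, given A4 (below `3` the only scalars sit at `Δ_ε`, resp. `Δ_σ`), as
uniqueness of the index below `3` in each scalar sector; for `Δ_ε ≥ 3` (outside every window of
interest) the clause only pins the index `e`. (3) The bulk conditions are those of `IsPositiveAt`
with the scalar gap "`ℓ = 0 → 3 ≤ Δ`" in place of "`ℓ = 0 → Δ < 3 → Δ = Δ_ε`" — the source's
convention "we take these constraints to hold for scalar[s] with `Δ ≥ 3`" (§2.2) and what (3.16)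
says away from the externals; at each bulk `(Δ, ℓ)` they are the `EvenPositive` / `OddPositive` of
`MixedCertificateObligations.lean` (not imported). (4) The external form is stated over ALL triples
of genuine external blocks `(g^{0,0}_{Δ_ε,0}, g^{Δ_σε,Δ_σε}_{Δ_σ,0}, g^{-Δ_σε,Δ_σε}_{Δ_σ,0})`, as
`IsPositiveAt` does, so that block uniqueness is never needed.
-/

noncomputable section

namespace Literature.MathematicalPhysics.QuantumFieldTheory.ConformalBootstrap3D

open Set

/-! ### Data side: isolated externals and the OPE-coefficient symmetry -/

namespace SigmaEpsilonData

/-- **Isolated externals with the OPE symmetry** (the standing assumption of the `θ`-scan): in the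
datum `D`, the even-sector index `e` is `ε` itself (`Δ_p e = Δ_ε`, `ℓ_p e = 0`) and every OTHER
even-sector scalar has `Δ ≥ 3`; the odd-sector index `s` is `σ` itself (`Δ_m s = Δ_σ`, `ℓ_m s = 0`)
and every other odd-sector scalar has `Δ ≥ 3` ("`σ` and `ε` are isolated and there are no other
contributions at their scaling dimensions"); and `λ_σεσ = λ_σσε` ("the constraint
`λ_σσε = λ_σεσ`"). Hypothesis structure on top of A1–A5.
[cite: KosPolandSimmonsDuffinVichi2016JHEP, §2.1 (isolation assumption; `λ_σσε = λ_σεσ`; arXiv:1603.04436)] -/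
structure HasIsolatedExternals (D : SigmaEpsilonData) (e : D.ιp) (s : D.ιm) : Prop where
  /-- the index `e` carries `ε`: dimension `Δ_ε`. -/
  Δp_eq : D.Δp e = D.Δε
  /-- the index `e` carries `ε`: spin `0`. -/
  ℓp_eq : D.ℓp e = 0
  /-- the index `s` carries `σ`: dimension `Δ_σ`. -/
  Δm_eq : D.Δm s = D.Δσ
  /-- the index `s` carries `σ`: spin `0`. -/
  ℓm_eq : D.ℓm s = 0
  /-- `e` is the only even-sector scalar below `3`. -/
  eq_of_even_scalar : ∀ i : D.ιp, D.ℓp i = 0 → D.Δp i < 3 → i = e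
  /-- `s` is the only odd-sector scalar below `3`. -/
  eq_of_odd_scalar : ∀ j : D.ιm, D.ℓm j = 0 → D.Δm j < 3 → j = s
  /-- the OPE-coefficient symmetry `λ_σεσ = λ_σσε`. -/
  lamσε_eq : D.lamσε s = D.lamσσ e

namespace HasIsolatedExternals

variable {D : SigmaEpsilonData} {e : D.ιp} {s : D.ιm}

/-- Away from `e`, even-sector scalars have `Δ ≥ 3`. Elementary (ours), serving
[cite: KosPolandSimmonsDuffinVichi2016JHEP, §2.1 (isolation assumption; arXiv:1603.04436)] -/
theorem three_le_Δp (h : D.HasIsolatedExternals e s) {i : D.ιp} (hi : i ≠ e) (h0 : D.ℓp i = 0) :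
    3 ≤ D.Δp i :=
  not_lt.mp fun hlt => hi (h.eq_of_even_scalar i h0 hlt)

/-- Away from `s`, odd-sector scalars have `Δ ≥ 3`. Elementary (ours), serving
[cite: KosPolandSimmonsDuffinVichi2016JHEP, §2.1 (isolation assumption; arXiv:1603.04436)] -/
theorem three_le_Δm (h : D.HasIsolatedExternals e s) {j : D.ιm} (hj : j ≠ s) (h0 : D.ℓm j = 0) :
    3 ≤ D.Δm j :=
  not_lt.mp fun hlt => hj (h.eq_of_odd_scalar j h0 hlt)

/-- Under A2 the block at `e` is a genuine `g^{0,0}_{Δ_ε,0}`. Elementary (ours), serving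
[cite: KosPolandSimmonsDuffinVichi2016JHEP, §2.1 (isolation assumption; arXiv:1603.04436)] -/
theorem block_ε (h : D.HasIsolatedExternals e s) (hB : D.HasGenuineBlocks) :
    IsConformalBlock3D 0 0 D.Δε 0 (D.gp e) := by
  have hg := hB.1 e
  rw [h.Δp_eq, h.ℓp_eq] at hg
  exact hg

/-- Under A2 the first block at `s` is a genuine `g^{Δ_σε,Δ_σε}_{Δ_σ,0}`. Elementary (ours), serving
[cite: KosPolandSimmonsDuffinVichi2016JHEP, §2.1 (isolation assumption; arXiv:1603.04436)] -/
theorem block_σ₁ (h : D.HasIsolatedExternals e s) (hB : D.HasGenuineBlocks) :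
    IsConformalBlock3D (D.Δσ - D.Δε) (D.Δσ - D.Δε) D.Δσ 0 (D.gmm s) := by
  have hg := hB.2.1 s
  rw [h.Δm_eq, h.ℓm_eq] at hg
  exact hg

/-- Under A2 the second block at `s` is a genuine `g^{-Δ_σε,Δ_σε}_{Δ_σ,0}`. Elementary (ours), serving
[cite: KosPolandSimmonsDuffinVichi2016JHEP, §2.1 (isolation assumption; arXiv:1603.04436)] -/
theorem block_σ₂ (h : D.HasIsolatedExternals e s) (hB : D.HasGenuineBlocks) :
    IsConformalBlock3D (-(D.Δσ - D.Δε)) (D.Δσ - D.Δε) D.Δσ 0 (D.gpm s) := by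
  have hg := hB.2.2 s
  rw [h.Δm_eq, h.ℓm_eq] at hg
  exact hg

end HasIsolatedExternals

end SigmaEpsilonData

/-! ### Functional side: the external form and the angle condition -/

namespace CrossingFunctional

variable (α : CrossingFunctional) (Δσ Δε : ℝ)

/-- **The external form**: for external blocks `g_ε = g^{0,0}_{Δ_ε,0}` (even sector) and
`g_σ = (g^{Δ_σε,Δ_σε}_{Δ_σ,0}, g^{-Δ_σε,Δ_σε}_{Δ_σ,0})` (odd sector),
`(a b) α⃗·(V⃗_{+,Δ_ε,0} + V⃗_{-,Δ_σ,0} ⊗ (1 0; 0 0)) (a; b) = evenForm[g_ε](a, b) + a² · oddForm₀[g_σ]`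
(the `⊗ (1 0; 0 0)` puts the odd-sector scalar `α⃗·V⃗_{-,Δ_σ,0}` into the `(1,1)` entry).
[cite: KosPolandSimmonsDuffinVichi2016JHEP, §2.1 (the combination `V⃗_{+,Δ_ε,0} + V⃗_{-,Δ_σ,0} ⊗ (1 0;0 0)`; arXiv:1603.04436)] -/
def externalForm (gε gσ₁ gσ₂ : ℝ → ℝ → ℝ) (a b : ℝ) : ℝ :=
  α.evenForm Δσ Δε gε a b + a ^ 2 * α.oddForm Δσ Δε 0 gσ₁ gσ₂

/-- The external form written out as a binary quadratic form
`a² (α¹[F^{σσ,σσ}_-[g_ε]] + α⃗·V⃗_{-,Δ_σ,0}[g_σ]) + b² α²[F^{εε,εε}_-[g_ε]] + a b (α⁴[F_-[g_ε]] + α⁵[F_+[g_ε]])`.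
Elementary (ours), serving
[cite: KosPolandSimmonsDuffinVichi2016JHEP, §2.1 (angle condition; arXiv:1603.04436)] -/
theorem externalForm_eq (gε gσ₁ gσ₂ : ℝ → ℝ → ℝ) (a b : ℝ) :
    α.externalForm Δσ Δε gε gσ₁ gσ₂ a b =
      a ^ 2 * (α.α₁ (crossF Δσ (-1) gε) + α.oddForm Δσ Δε 0 gσ₁ gσ₂)
        + b ^ 2 * α.α₂ (crossF Δε (-1) gε)
        + a * b * (α.α₄ (crossF ((Δσ + Δε) / 2) (-1) gε) + α.α₅ (crossF ((Δσ + Δε) / 2) 1 gε)) := by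
  unfold externalForm evenForm
  ring

/-- Homogeneity: the external form is quadratic in the direction, `q(t a, t b) = t² q(a, b)`.
Elementary (ours), serving
[cite: KosPolandSimmonsDuffinVichi2016JHEP, §2.1 (angle condition; arXiv:1603.04436)] -/
theorem externalForm_smul (gε gσ₁ gσ₂ : ℝ → ℝ → ℝ) (t a b : ℝ) :
    α.externalForm Δσ Δε gε gσ₁ gσ₂ (t * a) (t * b) = t ^ 2 * α.externalForm Δσ Δε gε gσ₁ gσ₂ a b := by
  unfold externalForm evenForm
  ring

/-- The cone identity of a binary quadratic form:
`q(l d₁ + m d₂) = l² q(d₁) + m² q(d₂) + l m (q(d₁ + d₂) - q(d₁) - q(d₂))`. Elementary (ours), serving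
[cite: KosPolandSimmonsDuffinVichi2016JHEP, §2.1 (angle condition; arXiv:1603.04436)] -/
theorem externalForm_combination (gε gσ₁ gσ₂ : ℝ → ℝ → ℝ) (l m a₁ b₁ a₂ b₂ : ℝ) :
    α.externalForm Δσ Δε gε gσ₁ gσ₂ (l * a₁ + m * a₂) (l * b₁ + m * b₂) =
      l ^ 2 * α.externalForm Δσ Δε gε gσ₁ gσ₂ a₁ b₁ + m ^ 2 * α.externalForm Δσ Δε gε gσ₁ gσ₂ a₂ b₂
        + l * m * (α.externalForm Δσ Δε gε gσ₁ gσ₂ (a₁ + a₂) (b₁ + b₂)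
            - α.externalForm Δσ Δε gε gσ₁ gσ₂ a₁ b₁ - α.externalForm Δσ Δε gε gσ₁ gσ₂ a₂ b₂) := by
  unfold externalForm evenForm
  ring

/-- **The cone rule** used by certificate checkers: if the external form is non-negative at two
directions `d₁ = (a₁, b₁)`, `d₂ = (a₂, b₂)` and the polarisation term
`B = q(d₁ + d₂) - q(d₁) - q(d₂)` satisfies `B ≥ 0` or `B² ≤ 4 q(d₁) q(d₂)` (copositivity of the
`2×2` Gram matrix on the quadrant), then it is non-negative on the whole closed cone
`{l d₁ + m d₂ : l, m ≥ 0}`. Elementary (ours, via `quadForm_nonneg_of_det`), serving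
[cite: KosPolandSimmonsDuffinVichi2016JHEP, §2.1 (angle condition; arXiv:1603.04436)] -/
theorem externalForm_nonneg_of_cone {gε gσ₁ gσ₂ : ℝ → ℝ → ℝ} {a₁ b₁ a₂ b₂ l m : ℝ}
    (hl : 0 ≤ l) (hm : 0 ≤ m) (h₁ : 0 ≤ α.externalForm Δσ Δε gε gσ₁ gσ₂ a₁ b₁)
    (h₂ : 0 ≤ α.externalForm Δσ Δε gε gσ₁ gσ₂ a₂ b₂)
    (hB : 0 ≤ α.externalForm Δσ Δε gε gσ₁ gσ₂ (a₁ + a₂) (b₁ + b₂)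
            - α.externalForm Δσ Δε gε gσ₁ gσ₂ a₁ b₁ - α.externalForm Δσ Δε gε gσ₁ gσ₂ a₂ b₂ ∨
          (α.externalForm Δσ Δε gε gσ₁ gσ₂ (a₁ + a₂) (b₁ + b₂)
            - α.externalForm Δσ Δε gε gσ₁ gσ₂ a₁ b₁ - α.externalForm Δσ Δε gε gσ₁ gσ₂ a₂ b₂) ^ 2
            ≤ 4 * α.externalForm Δσ Δε gε gσ₁ gσ₂ a₁ b₁ * α.externalForm Δσ Δε gε gσ₁ gσ₂ a₂ b₂) :
    0 ≤ α.externalForm Δσ Δε gε gσ₁ gσ₂ (l * a₁ + m * a₂) (l * b₁ + m * b₂) := by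
  rw [externalForm_combination]
  rcases hB with hB | hB
  · have h1 : 0 ≤ l ^ 2 * α.externalForm Δσ Δε gε gσ₁ gσ₂ a₁ b₁ := mul_nonneg (sq_nonneg l) h₁
    have h2 : 0 ≤ m ^ 2 * α.externalForm Δσ Δε gε gσ₁ gσ₂ a₂ b₂ := mul_nonneg (sq_nonneg m) h₂
    have h3 := mul_nonneg (mul_nonneg hl hm) hB
    linarith
  · exact quadForm_nonneg_of_det h₁ h₂ hB l m

/-- **Bulk positivity** at the external point `(Δ_σ, Δ_ε)`: the second and third lines of the
positivity conditions away from the externals — `α⃗·V⃗_{+,Δ,ℓ} ⪰ 0` for every even `ℓ`,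
`Δ ≥` the unitarity bound, scalars only with `Δ ≥ 3`, on every genuine block `g^{0,0}_{Δ,ℓ}`; and
`α⃗·V⃗_{-,Δ,ℓ} ≥ 0` for every `ℓ`, `Δ ≥` the bound, scalars only with `Δ ≥ 3`, on every pair of
genuine blocks `g^{±Δ_σε,Δ_σε}_{Δ,ℓ}`.
[cite: KosPolandSimmonsDuffinVichi2016JHEP, §2.1 (conditions for `ℤ₂`-even and `ℤ₂`-odd operators; arXiv:1603.04436)] -/
def IsBulkPositive : Prop :=
  (∀ (Δ : ℝ) (ℓ : ℕ) (g : ℝ → ℝ → ℝ), Even ℓ → unitarityBound3D ℓ ≤ Δ → (ℓ = 0 → 3 ≤ Δ) →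
      IsConformalBlock3D 0 0 Δ ℓ g → ∀ a b : ℝ, 0 ≤ α.evenForm Δσ Δε g a b) ∧
    ∀ (Δ : ℝ) (ℓ : ℕ) (g₁ g₂ : ℝ → ℝ → ℝ), unitarityBound3D ℓ ≤ Δ → (ℓ = 0 → 3 ≤ Δ) →
      IsConformalBlock3D (Δσ - Δε) (Δσ - Δε) Δ ℓ g₁ →
        IsConformalBlock3D (-(Δσ - Δε)) (Δσ - Δε) Δ ℓ g₂ → 0 ≤ α.oddForm Δσ Δε ℓ g₁ g₂

/-- **The external condition in the direction `(a, b)`**: `(a b) α⃗·(V⃗_{+,Δ_ε,0} + V⃗_{-,Δ_σ,0} ⊗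
(1 0; 0 0)) (a; b) ≥ 0` for every triple of genuine external blocks.
[cite: KosPolandSimmonsDuffinVichi2016JHEP, §2.1 (angle condition; arXiv:1603.04436)] -/
def IsExtNonnegAt (a b : ℝ) : Prop :=
  ∀ gε gσ₁ gσ₂ : ℝ → ℝ → ℝ, IsConformalBlock3D 0 0 Δε 0 gε →
    IsConformalBlock3D (Δσ - Δε) (Δσ - Δε) Δσ 0 gσ₁ →
      IsConformalBlock3D (-(Δσ - Δε)) (Δσ - Δε) Δσ 0 gσ₂ → 0 ≤ α.externalForm Δσ Δε gε gσ₁ gσ₂ a b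

/-- **Positivity with the OPE symmetry, matrix version** ("`⪰ 0`", the condition the source calls
"still stronger than necessary"): identity term `> 0`, bulk positivity, and the external form
non-negative in EVERY direction.
[cite: KosPolandSimmonsDuffinVichi2016JHEP, §2.1 (combination `⪰ 0`; arXiv:1603.04436)] -/
def IsPositiveAtSym : Prop :=
  0 < α.identityTerm Δσ Δε ∧ α.IsBulkPositive Δσ Δε ∧ ∀ a b : ℝ, α.IsExtNonnegAt Δσ Δε a b

/-- **Positivity at the OPE angle `θ`** (the weaker condition): identity term `> 0`, bulk
positivity, and the external form non-negative in the single direction `(cos θ, sin θ)`.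
[cite: KosPolandSimmonsDuffinVichi2016JHEP, §2.1 (angle condition, `θ = tan⁻¹(λ_εεε/λ_σσε)`; arXiv:1603.04436)] -/
def IsPositiveAtAngle (θ : ℝ) : Prop :=
  0 < α.identityTerm Δσ Δε ∧ α.IsBulkPositive Δσ Δε ∧ α.IsExtNonnegAt Δσ Δε (Real.cos θ) (Real.sin θ)

variable {α Δσ Δε}

/-- Homogeneity of the external condition: directions `(a, b)` and `t (a, b)`, `t ≠ 0`, are the
same check (a checker may test any convenient, e.g. rational, vector on the line). Elementary (ours), serving
[cite: KosPolandSimmonsDuffinVichi2016JHEP, §2.1 (angle condition; arXiv:1603.04436)] -/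
theorem isExtNonnegAt_smul_iff {t : ℝ} (ht : t ≠ 0) (a b : ℝ) :
    α.IsExtNonnegAt Δσ Δε (t * a) (t * b) ↔ α.IsExtNonnegAt Δσ Δε a b := by
  have ht2 : 0 < t ^ 2 := by positivity
  simp only [IsExtNonnegAt, externalForm_smul, mul_nonneg_iff_of_pos_left ht2]

/-- In particular `(a, b)` and `(-a, -b)` are the same check. Elementary (ours), serving
[cite: KosPolandSimmonsDuffinVichi2016JHEP, §2.1 (angle condition; arXiv:1603.04436)] -/
theorem isExtNonnegAt_neg_iff (a b : ℝ) :
    α.IsExtNonnegAt Δσ Δε (-a) (-b) ↔ α.IsExtNonnegAt Δσ Δε a b := by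
  have h := isExtNonnegAt_smul_iff (α := α) (Δσ := Δσ) (Δε := Δε) (t := -1) (by norm_num) a b
  simpa using h

/-- `π`-periodicity: the angle condition at `θ + π` is the angle condition at `θ` (the scan runs
over a half-turn). Elementary (ours), serving
[cite: KosPolandSimmonsDuffinVichi2016JHEP, §2.1 (angle condition; arXiv:1603.04436)] -/
theorem isPositiveAtAngle_add_pi_iff (θ : ℝ) :
    α.IsPositiveAtAngle Δσ Δε (θ + Real.pi) ↔ α.IsPositiveAtAngle Δσ Δε θ := by
  simp only [IsPositiveAtAngle, Real.cos_add_pi, Real.sin_add_pi, isExtNonnegAt_neg_iff]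

/-- The 2014 conditions (3.16) imply the matrix version with the OPE symmetry (instantiate the
even line at `(Δ_ε, 0)` and the odd line at `(Δ_σ, 0)`, both allowed by the gaps, and add).
Requires `Δ_σ, Δ_ε ≥` the scalar unitarity bound (part of A1). Elementary (ours), serving
[cite: KosPolandSimmonsDuffinVichi2016JHEP, §2.1 ("still stronger than necessary"; arXiv:1603.04436)] -/
theorem IsPositiveAt.isPositiveAtSym (h : α.IsPositiveAt Δσ Δε) (hσ : unitarityBound3D 0 ≤ Δσ)
    (hε : unitarityBound3D 0 ≤ Δε) : α.IsPositiveAtSym Δσ Δε := by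
  obtain ⟨hI, hev, hodd⟩ := h
  refine ⟨hI, ⟨?_, ?_⟩, ?_⟩
  · intro Δ ℓ g hℓ hb hgap hg a b
    exact hev Δ ℓ g hℓ hb (fun h0 hlt => absurd hlt (not_lt.mpr (hgap h0))) hg a b
  · intro Δ ℓ g₁ g₂ hb hgap hg₁ hg₂
    exact hodd Δ ℓ g₁ g₂ hb (fun h0 hlt => absurd hlt (not_lt.mpr (hgap h0))) hg₁ hg₂
  · intro a b gε gσ₁ gσ₂ hgε hgσ₁ hgσ₂
    have h1 : 0 ≤ α.evenForm Δσ Δε gε a b := hev Δε 0 gε ⟨0, rfl⟩ hε (fun _ _ => rfl) hgε a b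
    have h2 : 0 ≤ α.oddForm Δσ Δε 0 gσ₁ gσ₂ := hodd Δσ 0 gσ₁ gσ₂ hσ (fun _ _ => rfl) hgσ₁ hgσ₂
    exact add_nonneg h1 (mul_nonneg (sq_nonneg a) h2)

/-- The matrix version implies the angle condition at every `θ`. Elementary (ours), serving
[cite: KosPolandSimmonsDuffinVichi2016JHEP, §2.1 ("still stronger than necessary"; arXiv:1603.04436)] -/
theorem IsPositiveAtSym.isPositiveAtAngle (h : α.IsPositiveAtSym Δσ Δε) (θ : ℝ) :
    α.IsPositiveAtAngle Δσ Δε θ :=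
  ⟨h.1, h.2.1, h.2.2 _ _⟩

/-! ### The mechanism: the dual form of crossing with the externals split off -/

/-- **The external terms against the identity.** For a datum satisfying A1 (bounds, even spins)
and A2 (genuine blocks) with isolated externals `(e, s)`, on which `α⃗` acts termwise and is
bulk-positive: `(λ_σσε λ_εεε)·α⃗·(V⃗_{+,Δ_ε,0} + V⃗_{-,Δ_σ,0} ⊗ (1 0;0 0))·(λ_σσε; λ_εεε)
+ (1 1) α⃗·V⃗_{+,0,0} (1;1) ≤ 0`. Proof: apply `αⁱ` to sum rule `i` and add (`AppliesTermwise`);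
split the index `e` off the even-sector series and `s` off the odd-sector series
(`Finset.hasSum_compl_iff`); the remaining terms are non-negative by bulk positivity (every other
scalar has `Δ ≥ 3`), and the two split-off terms are the external form at `(λ_σσε, λ_εεε)` because
`λ_σεσ = λ_σσε` and `ℓ_m s = 0`.
[cite: KosPolandSimmonsDuffinVichi2016JHEP, §2.1 (angle condition and norm bound; arXiv:1603.04436)] -/
theorem externalForm_add_identityTerm_nonpos (α : CrossingFunctional) (D : SigmaEpsilonData)
    (hU : D.SatisfiesUnitarity) (hB : D.HasGenuineBlocks) {e : D.ιp} {s : D.ιm}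
    (hI : D.HasIsolatedExternals e s) (hT : α.AppliesTermwise D)
    (hbulk : α.IsBulkPositive D.Δσ D.Δε) :
    α.externalForm D.Δσ D.Δε (D.gp e) (D.gmm s) (D.gpm s) (D.lamσσ e) (D.lamεε e)
      + α.identityTerm D.Δσ D.Δε ≤ 0 := by
  obtain ⟨h1, h2, h3, ⟨Sp, Sm, h4p, h4m, h4e⟩, ⟨Sp', Sm', h5p, h5m, h5e⟩⟩ := hT
  obtain ⟨hev, hodd⟩ := hbulk
  obtain ⟨_, _, hbp, hevs, hbm⟩ := hU
  obtain ⟨hgp, hgmm, hgpm⟩ := hB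
  -- the even-sector series, term by term the quadratic form at `(λ_σσ𝒪, λ_εε𝒪)`
  have hE : HasSum (fun i => α.evenForm D.Δσ D.Δε (D.gp i) (D.lamσσ i) (D.lamεε i))
      (-(α.α₁ (crossF D.Δσ (-1) (fun _ _ => (1 : ℝ))))
        + -(α.α₂ (crossF D.Δε (-1) (fun _ _ => (1 : ℝ)))) + (Sp + Sp')) := by
    have hs := (h1.add h2).add (h4p.add h5p)
    refine hs.congr_fun ?_
    intro i
    simp only [evenForm]
    ring
  -- split off the index `e`
  have hE' : HasSum
      (fun x : {x // x ∉ ({e} : Finset D.ιp)} =>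
        α.evenForm D.Δσ D.Δε (D.gp x) (D.lamσσ x) (D.lamεε x))
      (-(α.α₁ (crossF D.Δσ (-1) (fun _ _ => (1 : ℝ))))
        + -(α.α₂ (crossF D.Δε (-1) (fun _ _ => (1 : ℝ)))) + (Sp + Sp')
        - α.evenForm D.Δσ D.Δε (D.gp e) (D.lamσσ e) (D.lamεε e)) := by
    rw [Finset.hasSum_compl_iff
      (f := fun i => α.evenForm D.Δσ D.Δε (D.gp i) (D.lamσσ i) (D.lamεε i))]
    simpa using hE
  have hEnn : 0 ≤ -(α.α₁ (crossF D.Δσ (-1) (fun _ _ => (1 : ℝ))))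
        + -(α.α₂ (crossF D.Δε (-1) (fun _ _ => (1 : ℝ)))) + (Sp + Sp')
        - α.evenForm D.Δσ D.Δε (D.gp e) (D.lamσσ e) (D.lamεε e) := by
    refine hE'.nonneg fun x => ?_
    have hne : (x : D.ιp) ≠ e := fun h => x.2 (by simp [h])
    exact hev (D.Δp x) (D.ℓp x) (D.gp x) (hevs x) (hbp x) (hI.three_le_Δp hne) (hgp x) _ _
  -- the odd-sector series, term by term `λ_σε𝒪² α⃗·V⃗₋`
  have hO : HasSum (fun j => D.lamσε j ^ 2 * α.oddForm D.Δσ D.Δε (D.ℓm j) (D.gmm j) (D.gpm j))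
      (0 + Sm - Sm') := by
    have hs := (h3.add h4m).sub h5m
    refine hs.congr_fun ?_
    intro j
    simp only [oddForm]
    ring
  -- split off the index `s`
  have hO' : HasSum
      (fun x : {x // x ∉ ({s} : Finset D.ιm)} =>
        D.lamσε x ^ 2 * α.oddForm D.Δσ D.Δε (D.ℓm x) (D.gmm x) (D.gpm x))
      (0 + Sm - Sm' - D.lamσε s ^ 2 * α.oddForm D.Δσ D.Δε (D.ℓm s) (D.gmm s) (D.gpm s)) := by
    rw [Finset.hasSum_compl_iff
      (f := fun j => D.lamσε j ^ 2 * α.oddForm D.Δσ D.Δε (D.ℓm j) (D.gmm j) (D.gpm j))]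
    simpa using hO
  have hOnn : 0 ≤ 0 + Sm - Sm'
      - D.lamσε s ^ 2 * α.oddForm D.Δσ D.Δε (D.ℓm s) (D.gmm s) (D.gpm s) := by
    refine hO'.nonneg fun x => ?_
    have hne : (x : D.ιm) ≠ s := fun h => x.2 (by simp [h])
    exact mul_nonneg (sq_nonneg _)
      (hodd (D.Δm x) (D.ℓm x) (D.gmm x) (D.gpm x) (hbm x) (hI.three_le_Δm hne) (hgmm x) (hgpm x))
  -- the two split-off terms are the external form at `(λ_σσε, λ_εεε)`
  have hext : α.externalForm D.Δσ D.Δε (D.gp e) (D.gmm s) (D.gpm s) (D.lamσσ e) (D.lamεε e)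
      = α.evenForm D.Δσ D.Δε (D.gp e) (D.lamσσ e) (D.lamεε e)
        + D.lamσε s ^ 2 * α.oddForm D.Δσ D.Δε (D.ℓm s) (D.gmm s) (D.gpm s) := by
    rw [externalForm, hI.lamσε_eq, hI.ℓm_eq]
  unfold identityTerm
  rw [hext]
  linarith

/-- **The angle condition excludes** (PROVED): a datum satisfying A1, A2 with isolated externals
`(e, s)`, on which `α⃗` acts termwise, cannot have `α⃗` positive at `(Δ_σ, Δ_ε, θ)` for an angle
`θ` of its own OPE vector, `(λ_σσε, λ_εεε) = r (cos θ, sin θ)`. Proof: by homogeneity the external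
form at `(λ_σσε, λ_εεε)` is `r²` times its value at `(cos θ, sin θ)`, hence `≥ 0`; add the
positive identity term and compare with `externalForm_add_identityTerm_nonpos`.
[cite: KosPolandSimmonsDuffinVichi2016JHEP, §2.1 (angle condition; arXiv:1603.04436)] -/
theorem not_isPositiveAtAngle_of_appliesTermwise (α : CrossingFunctional) (D : SigmaEpsilonData)
    (hU : D.SatisfiesUnitarity) (hB : D.HasGenuineBlocks) {e : D.ιp} {s : D.ιm}
    (hI : D.HasIsolatedExternals e s) (hT : α.AppliesTermwise D) {θ r : ℝ}
    (ha : D.lamσσ e = r * Real.cos θ) (hb : D.lamεε e = r * Real.sin θ)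
    (hpos : α.IsPositiveAtAngle D.Δσ D.Δε θ) : False := by
  obtain ⟨hId, hbulk, hext⟩ := hpos
  have key := externalForm_add_identityTerm_nonpos α D hU hB hI hT hbulk
  have hx : 0 ≤ α.externalForm D.Δσ D.Δε (D.gp e) (D.gmm s) (D.gpm s) (Real.cos θ) (Real.sin θ) :=
    hext _ _ _ (hI.block_ε hB) (hI.block_σ₁ hB) (hI.block_σ₂ hB)
  have hsc : α.externalForm D.Δσ D.Δε (D.gp e) (D.gmm s) (D.gpm s) (D.lamσσ e) (D.lamεε e)
      = r ^ 2 * α.externalForm D.Δσ D.Δε (D.gp e) (D.gmm s) (D.gpm s) (Real.cos θ) (Real.sin θ) := by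
    rw [ha, hb, externalForm_smul]
  have h2 : 0 ≤ r ^ 2 * α.externalForm D.Δσ D.Δε (D.gp e) (D.gmm s) (D.gpm s)
      (Real.cos θ) (Real.sin θ) := mul_nonneg (sq_nonneg r) hx
  linarith

/-- **The `θ`-scan** (PROVED): if for EVERY `θ ∈ [0, π)` some functional acting termwise on `D` is
positive at `(Δ_σ, Δ_ε, θ)`, the datum (A1, A2, isolated externals) cannot exist — its OPE vector
`(λ_σσε, λ_εεε)` has SOME angle in the half-turn (`ONOPEAngleScan.exists_norm_angle_Ico`, with a
signed norm). "By scanning over the possible values of `θ` and taking the union of the resulting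
allowed regions". [cite: KosPolandSimmonsDuffinVichi2016JHEP, §2.1 (`θ`-scan; arXiv:1603.04436)] -/
theorem false_of_forall_angle (D : SigmaEpsilonData) (hU : D.SatisfiesUnitarity)
    (hB : D.HasGenuineBlocks) {e : D.ιp} {s : D.ιm} (hI : D.HasIsolatedExternals e s)
    (hscan : ∀ θ ∈ Ico 0 Real.pi, ∃ α : CrossingFunctional,
      α.AppliesTermwise D ∧ α.IsPositiveAtAngle D.Δσ D.Δε θ) : False := by
  obtain ⟨r, θ, hθ, -, ha, hb⟩ := ONOPEAngleScan.exists_norm_angle_Ico (D.lamσσ e) (D.lamεε e)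
  obtain ⟨α, hT, hpos⟩ := hscan θ hθ
  exact not_isPositiveAtAngle_of_appliesTermwise α D hU hB hI hT ha hb hpos

/-- **The OPE-norm bound** (PROVED): if `α⃗` acts termwise on `D` (A1, A2, isolated externals), is
bulk-positive at `(Δ_σ, Δ_ε)`, and its external form takes the value `𝒩` in the direction
`(cos θ, sin θ)` of the OPE vector `(λ_σσε, λ_εεε) = r (cos θ, sin θ)` (on every triple of genuine
external blocks), then `𝒩 · (λ_σσε² + λ_εεε²) ≤ -(1 1) α⃗·V⃗_{+,0,0} (1;1)`. With `𝒩 = 1` this is an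
upper bound on `λ_ε²`, with `𝒩 = -1` a lower bound; no sign condition on the identity term is
needed. [cite: KosPolandSimmonsDuffinVichi2016JHEP, §2.1 (norm bound `𝒩 λ_ε² ≤ -(1 1)α⃗·V⃗_{+,0,0}(1 1)ᵀ`; arXiv:1603.04436)] -/
theorem opeNormSq_bound (α : CrossingFunctional) (D : SigmaEpsilonData)
    (hU : D.SatisfiesUnitarity) (hB : D.HasGenuineBlocks) {e : D.ιp} {s : D.ιm}
    (hI : D.HasIsolatedExternals e s) (hT : α.AppliesTermwise D)
    (hbulk : α.IsBulkPositive D.Δσ D.Δε) {θ r N : ℝ}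
    (ha : D.lamσσ e = r * Real.cos θ) (hb : D.lamεε e = r * Real.sin θ)
    (hN : ∀ gε gσ₁ gσ₂ : ℝ → ℝ → ℝ, IsConformalBlock3D 0 0 D.Δε 0 gε →
      IsConformalBlock3D (D.Δσ - D.Δε) (D.Δσ - D.Δε) D.Δσ 0 gσ₁ →
        IsConformalBlock3D (-(D.Δσ - D.Δε)) (D.Δσ - D.Δε) D.Δσ 0 gσ₂ →
          α.externalForm D.Δσ D.Δε gε gσ₁ gσ₂ (Real.cos θ) (Real.sin θ) = N) :
    N * (D.lamσσ e ^ 2 + D.lamεε e ^ 2) ≤ -α.identityTerm D.Δσ D.Δε := by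
  have key := externalForm_add_identityTerm_nonpos α D hU hB hI hT hbulk
  have hsc : α.externalForm D.Δσ D.Δε (D.gp e) (D.gmm s) (D.gpm s) (D.lamσσ e) (D.lamεε e)
      = r ^ 2 * N := by
    rw [ha, hb, externalForm_smul, hN _ _ _ (hI.block_ε hB) (hI.block_σ₁ hB) (hI.block_σ₂ hB)]
  have hr : D.lamσσ e ^ 2 + D.lamεε e ^ 2 = r ^ 2 := by
    rw [ha, hb, mul_pow, mul_pow, ← mul_add, Real.cos_sq_add_sin_sq, mul_one]
  rw [hr, mul_comm N]
  linarith

/-! ### Certificate side: cones of directions -/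

/-- **Positivity on a cone of directions** at `(Δ_σ, Δ_ε)`, the shape one certificate of a
`θ`-scan cell has: identity term `> 0`, bulk positivity, and — for every triple of genuine
external blocks — the external form non-negative at the two directions `d₁ = (a₁, b₁)`,
`d₂ = (a₂, b₂)` with the polarisation condition of `externalForm_nonneg_of_cone`.
Elementary packaging (ours), serving
[cite: KosPolandSimmonsDuffinVichi2016JHEP, §2.1 (`θ`-scan; arXiv:1603.04436)] -/
def IsPositiveOnCone (α : CrossingFunctional) (Δσ Δε a₁ b₁ a₂ b₂ : ℝ) : Prop :=
  0 < α.identityTerm Δσ Δε ∧ α.IsBulkPositive Δσ Δε ∧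
    ∀ gε gσ₁ gσ₂ : ℝ → ℝ → ℝ, IsConformalBlock3D 0 0 Δε 0 gε →
      IsConformalBlock3D (Δσ - Δε) (Δσ - Δε) Δσ 0 gσ₁ →
        IsConformalBlock3D (-(Δσ - Δε)) (Δσ - Δε) Δσ 0 gσ₂ →
          0 ≤ α.externalForm Δσ Δε gε gσ₁ gσ₂ a₁ b₁ ∧ 0 ≤ α.externalForm Δσ Δε gε gσ₁ gσ₂ a₂ b₂ ∧
            (0 ≤ α.externalForm Δσ Δε gε gσ₁ gσ₂ (a₁ + a₂) (b₁ + b₂)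
                - α.externalForm Δσ Δε gε gσ₁ gσ₂ a₁ b₁ - α.externalForm Δσ Δε gε gσ₁ gσ₂ a₂ b₂ ∨
              (α.externalForm Δσ Δε gε gσ₁ gσ₂ (a₁ + a₂) (b₁ + b₂)
                - α.externalForm Δσ Δε gε gσ₁ gσ₂ a₁ b₁ - α.externalForm Δσ Δε gε gσ₁ gσ₂ a₂ b₂) ^ 2
                ≤ 4 * α.externalForm Δσ Δε gε gσ₁ gσ₂ a₁ b₁ * α.externalForm Δσ Δε gε gσ₁ gσ₂ a₂ b₂)

/-- A functional positive on the cone of `d₁, d₂` is positive at every angle whose direction is a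
non-negative combination of `d₁, d₂`. Elementary (ours), serving
[cite: KosPolandSimmonsDuffinVichi2016JHEP, §2.1 (`θ`-scan; arXiv:1603.04436)] -/
theorem IsPositiveOnCone.isPositiveAtAngle {a₁ b₁ a₂ b₂ : ℝ}
    (h : α.IsPositiveOnCone Δσ Δε a₁ b₁ a₂ b₂) {θ l m : ℝ} (hl : 0 ≤ l) (hm : 0 ≤ m)
    (hc : Real.cos θ = l * a₁ + m * a₂) (hs : Real.sin θ = l * b₁ + m * b₂) :
    α.IsPositiveAtAngle Δσ Δε θ := by
  refine ⟨h.1, h.2.1, ?_⟩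
  intro gε gσ₁ gσ₂ hgε hgσ₁ hgσ₂
  obtain ⟨h₁, h₂, hB⟩ := h.2.2 gε gσ₁ gσ₂ hgε hgσ₁ hgσ₂
  rw [hc, hs]
  exact externalForm_nonneg_of_cone α Δσ Δε hl hm h₁ h₂ hB

/-- **Slope cells cover the half-turn.** For any finite list of slopes `x_0, …, x_N` (`N ≥ 1`;
no ordering is needed) every direction `(cos θ, sin θ)` with `θ ∈ [0, π)` is a non-negative
combination either of `(x_N, 1)` and `(1, 0)` (small angles), or of `(x_0, 1)` and `(-1, 0)`
(angles near `π`), or of two consecutive `(x_k, 1)`, `(x_{k+1}, 1)` (`k < N`). (For `θ ∈ (0, π)`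
the direction is `sin θ · (cot θ, 1)` and `cot θ` lies in `(-∞, x_0]`, `[x_N, ∞)` or some
`[x_k, x_{k+1}]` by `exists_step_of_mem_Icc`; `θ = 0` is `(1, 0)` itself.) Elementary (ours), serving
[cite: KosPolandSimmonsDuffinVichi2016JHEP, §2.1 (`θ`-scan; arXiv:1603.04436)] -/
theorem exists_cone_of_angle (x : ℕ → ℝ) {N : ℕ} (hN : 1 ≤ N) {θ : ℝ}
    (hθ : θ ∈ Ico 0 Real.pi) :
    (∃ l m : ℝ, 0 ≤ l ∧ 0 ≤ m ∧ Real.cos θ = l * x N + m * 1 ∧ Real.sin θ = l * 1 + m * 0) ∨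
      (∃ l m : ℝ, 0 ≤ l ∧ 0 ≤ m ∧ Real.cos θ = l * x 0 + m * (-1) ∧ Real.sin θ = l * 1 + m * 0) ∨
        ∃ k, k < N ∧ ∃ l m : ℝ, 0 ≤ l ∧ 0 ≤ m ∧
          Real.cos θ = l * x k + m * x (k + 1) ∧ Real.sin θ = l * 1 + m * 1 := by
  have hs0 : 0 ≤ Real.sin θ := Real.sin_nonneg_of_nonneg_of_le_pi hθ.1 hθ.2.le
  rcases hs0.eq_or_lt with hs | hs
  · -- `sin θ = 0`: `θ = 0`, direction `(1, 0)`
    have hθ0 : θ = 0 :=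
      (Real.sin_eq_zero_iff_of_lt_of_lt (by linarith [hθ.1, Real.pi_pos]) hθ.2).mp hs.symm
    refine Or.inl ⟨0, 1, le_rfl, zero_le_one, ?_, ?_⟩
    · simp [hθ0]
    · simp [hθ0]
  · -- `sin θ > 0`: slope `u = cos θ / sin θ`
    set c := Real.cos θ with hc
    set σ := Real.sin θ with hσ
    set u := c / σ with hu
    have hcu : c = σ * u := by rw [hu]; field_simp
    rcases le_or_gt (x N) u with hR | hR
    · refine Or.inl ⟨σ, σ * (u - x N), hs.le, mul_nonneg hs.le (sub_nonneg.mpr hR), ?_, ?_⟩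
      · rw [hcu]; ring
      · ring
    rcases le_or_gt u (x 0) with hL | hL
    · refine Or.inr (Or.inl ⟨σ, σ * (x 0 - u), hs.le, mul_nonneg hs.le (sub_nonneg.mpr hL), ?_, ?_⟩)
      · rw [hcu]; ring
      · ring
    obtain ⟨k, hk, hk1, hk2⟩ := exists_step_of_mem_Icc x hN hL.le hR.le
    refine Or.inr (Or.inr ⟨k, hk, ?_⟩)
    rcases (hk1.trans hk2).eq_or_lt with heq | hlt
    · -- degenerate cell `x_k = x_{k+1}`: then `u = x_k`
      have huk : u = x k := le_antisymm (heq ▸ hk2) hk1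
      refine ⟨σ, 0, hs.le, le_rfl, ?_, ?_⟩
      · rw [hcu, huk]; ring
      · ring
    · have hd : 0 < x (k + 1) - x k := sub_pos.mpr hlt
      refine ⟨σ * ((x (k + 1) - u) / (x (k + 1) - x k)), σ * ((u - x k) / (x (k + 1) - x k)),
        mul_nonneg hs.le (div_nonneg (sub_nonneg.mpr hk2) hd.le),
        mul_nonneg hs.le (div_nonneg (sub_nonneg.mpr hk1) hd.le), ?_, ?_⟩
      · rw [hcu]
        field_simp
        ring
      · field_simp
        ring

end CrossingFunctional

/-! ### Enclosure level: exclusion for data with isolated externals -/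

/-- **Exclusion for data with isolated externals.** No datum satisfying the typed axioms A1–A5 AND
having isolated externals with the OPE symmetry has `(Δ_σ, Δ_ε) ∈ Q`. Weaker than `BoxExcluded Q`
(more hypotheses on the datum) — this is the predicate the `θ`-scan establishes.
[cite: KosPolandSimmonsDuffinVichi2016JHEP, §2.1 (allowed region under the isolation assumption; arXiv:1603.04436)] -/
def IsoExcluded (Q : Set (ℝ × ℝ)) : Prop :=
  ∀ D : SigmaEpsilonData, D.SatisfiesBootstrapAxioms →
    ∀ (e : D.ιp) (s : D.ιm), D.HasIsolatedExternals e s → (D.Δσ, D.Δε) ∉ Q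

/-- **Exclusion in `(Δ_σ, Δ_ε, θ)` space.** No datum satisfying A1–A5 with isolated externals
`(e, s)` has `(Δ_σ, Δ_ε, θ) ∈ T` for any angle `θ` of its OPE vector,
`(λ_σσε, λ_εεε) = r (cos θ, sin θ)`. ("for any given allowed point in the `(Δ_σ, Δ_ε, θ)` space".)
[cite: KosPolandSimmonsDuffinVichi2016JHEP, §2.1 (`(Δ_σ, Δ_ε, θ)` space; arXiv:1603.04436)] -/
def TripleExcluded (T : Set (ℝ × ℝ × ℝ)) : Prop :=
  ∀ D : SigmaEpsilonData, D.SatisfiesBootstrapAxioms →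
    ∀ (e : D.ιp) (s : D.ιm), D.HasIsolatedExternals e s →
      ∀ θ r : ℝ, D.lamσσ e = r * Real.cos θ → D.lamεε e = r * Real.sin θ → (D.Δσ, D.Δε, θ) ∉ T

/-- An excluded box is excluded for data with isolated externals. Elementary (ours), serving
[cite: KosPolandSimmonsDuffinVichi2016JHEP, §2.1 (`θ`-scan; arXiv:1603.04436)] -/
theorem BoxExcluded.isoExcluded {Q : Set (ℝ × ℝ)} (h : BoxExcluded Q) : IsoExcluded Q :=
  fun D hD _ _ _ => h D hD

/-- Monotonicity. Elementary (ours), serving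
[cite: KosPolandSimmonsDuffinVichi2016JHEP, §2.1 (`θ`-scan; arXiv:1603.04436)] -/
theorem IsoExcluded.mono {Q Q' : Set (ℝ × ℝ)} (h : IsoExcluded Q) (hQ' : Q' ⊆ Q) :
    IsoExcluded Q' :=
  fun D hD e s hI hmem => h D hD e s hI (hQ' hmem)

/-- Monotonicity. Elementary (ours), serving
[cite: KosPolandSimmonsDuffinVichi2016JHEP, §2.1 (`θ`-scan; arXiv:1603.04436)] -/
theorem TripleExcluded.mono {T T' : Set (ℝ × ℝ × ℝ)} (h : TripleExcluded T) (hT' : T' ⊆ T) :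
    TripleExcluded T' :=
  fun D hD e s hI θ r ha hb hmem => h D hD e s hI θ r ha hb (hT' hmem)

/-- **Exclusion of a set of triples by functionals** (PROVED from `AppliesTermwise` for
evaluation-continuous functionals): if at every `(Δ_σ, Δ_ε, θ) ∈ T` some evaluation-continuous
`α⃗` is positive at the angle, then `T` is excluded.
[cite: KosPolandSimmonsDuffinVichi2016JHEP, §2.1 (angle condition; arXiv:1603.04436)] -/
theorem tripleExcluded_of_functional (T : Set (ℝ × ℝ × ℝ))
    (h : ∀ t ∈ T, ∃ α : CrossingFunctional,
      α.IsEvaluationContinuous ∧ α.IsPositiveAtAngle t.1 t.2.1 t.2.2) :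
    TripleExcluded T := by
  intro D hD e s hI θ r ha hb ht
  obtain ⟨hB, hU, _, hC, _⟩ := hD
  obtain ⟨α, hα, hpos⟩ := h _ ht
  exact CrossingFunctional.not_isPositiveAtAngle_of_appliesTermwise α D hU hB hI
    (CrossingFunctional.appliesTermwise_of_isEvaluationContinuous α hα D hC) ha hb hpos

/-- **Scanning a half-turn suffices**: if every triple `(Δ_σ, Δ_ε, θ)` with `(Δ_σ, Δ_ε) ∈ Q` and
`θ ∈ [0, π)` is excluded, then `Q` is excluded for data with isolated externals.
[cite: KosPolandSimmonsDuffinVichi2016JHEP, §2.1 (`θ`-scan, union of allowed regions; arXiv:1603.04436)] -/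
theorem isoExcluded_of_tripleExcluded {Q : Set (ℝ × ℝ)}
    (h : TripleExcluded {t | (t.1, t.2.1) ∈ Q ∧ t.2.2 ∈ Ico 0 Real.pi}) : IsoExcluded Q := by
  intro D hD e s hI hQ
  obtain ⟨r, θ, hθ, -, ha, hb⟩ :=
    ONOPEAngleScan.exists_norm_angle_Ico (D.lamσσ e) (D.lamεε e)
  exact h D hD e s hI θ r ha hb ⟨hQ, hθ⟩

/-- **The `θ`-scan excludes a box**: one evaluation-continuous functional per point and angle,
positive at that `(Δ_σ, Δ_ε, θ)`, for all `(Δ_σ, Δ_ε) ∈ Q` and `θ ∈ [0, π)`, gives `IsoExcluded Q`.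
[cite: KosPolandSimmonsDuffinVichi2016JHEP, §2.1 (`θ`-scan; arXiv:1603.04436)] -/
theorem isoExcluded_of_functionals (Q : Set (ℝ × ℝ))
    (h : ∀ p ∈ Q, ∀ θ ∈ Ico 0 Real.pi, ∃ α : CrossingFunctional,
      α.IsEvaluationContinuous ∧ α.IsPositiveAtAngle p.1 p.2 θ) :
    IsoExcluded Q :=
  isoExcluded_of_tripleExcluded
    (tripleExcluded_of_functional _ fun t ht => h (t.1, t.2.1) ht.1 t.2.2 ht.2)

/-- **Finite `θ`-scan certificate shape.** Slopes `x_0, …, x_N` (`N ≥ 1`; meant increasing, but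
no ordering is used) cut the half-turn of directions into `N` slope cells and two end cells; if for
each cell
some evaluation-continuous functional is positive on that cell's cone of directions at EVERY point
of `Q`, then `Q` is excluded for data with isolated externals. (The per-cell conditions are the
three entrywise checks of `IsPositiveOnCone` on top of bulk positivity; `exists_cone_of_angle`
supplies the cell of each angle.) Elementary assembly (ours), serving
[cite: KosPolandSimmonsDuffinVichi2016JHEP, §2.1 (`θ`-scan; arXiv:1603.04436)] -/
theorem isoExcluded_of_slopeCells (Q : Set (ℝ × ℝ)) (x : ℕ → ℝ) {N : ℕ} (hN : 1 ≤ N)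
    (hR : ∃ α : CrossingFunctional, α.IsEvaluationContinuous ∧
      ∀ p ∈ Q, α.IsPositiveOnCone p.1 p.2 (x N) 1 1 0)
    (hL : ∃ α : CrossingFunctional, α.IsEvaluationContinuous ∧
      ∀ p ∈ Q, α.IsPositiveOnCone p.1 p.2 (x 0) 1 (-1) 0)
    (hk : ∀ k, k < N → ∃ α : CrossingFunctional, α.IsEvaluationContinuous ∧
      ∀ p ∈ Q, α.IsPositiveOnCone p.1 p.2 (x k) 1 (x (k + 1)) 1) :
    IsoExcluded Q := by
  refine isoExcluded_of_functionals Q fun p hp θ hθ => ?_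
  rcases CrossingFunctional.exists_cone_of_angle x hN hθ with
    ⟨l, m, hl, hm, hc, hs⟩ | ⟨l, m, hl, hm, hc, hs⟩ | ⟨k, hkN, l, m, hl, hm, hc, hs⟩
  · obtain ⟨α, hα, hcone⟩ := hR
    exact ⟨α, hα, (hcone p hp).isPositiveAtAngle hl hm hc hs⟩
  · obtain ⟨α, hα, hcone⟩ := hL
    exact ⟨α, hα, (hcone p hp).isPositiveAtAngle hl hm hc hs⟩
  · obtain ⟨α, hα, hcone⟩ := hk k hkN
    exact ⟨α, hα, (hcone p hp).isPositiveAtAngle hl hm hc hs⟩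

end Literature.MathematicalPhysics.QuantumFieldTheory.ConformalBootstrap3D

end
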